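import Summits.KontsevichZagierPeriods.Zeta5Search.Barrier.ConeGammaSavingEval
import Summits.KontsevichZagierPeriods.Zeta5Search.Barrier.ConeGammaPeriodDigamma
import Literature.Analysis.ValidatedNumerics.DigammaKernelValues

/-!
# ζ(5) search — BARRIER: the GAP CERTIFICATE — `Φ(a)` as an exact finite digamma sum from a checked table

HONEST FRAMING (cell `pub-zeta5`): systematic search; no irrationality claim unless kernel-certified. MODEL objects
under Brown–Zudilin's (28)+(30) accounting ([BZ22] = arXiv:2210.03391); nothing here is a statement about `ζ(5)`;
records in print UNMOVED. Theory seat cert-2 g18 (the `hΦ` certificate-table design asked for in `BARRIER-PLAN.md`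
LEAD ADDENDUM 7 (J4)/(J7)): for a direction `a` of the closed box whose 28 forms are natural numbers `H k`
(an integer parameter vector; period `T = 1`), a CERTIFICATE is
* a common denominator `L` and the breakpoint numerators `0 = B₀ < B₁ < ⋯ < B_M = L` of one period of the orbit
  `u ↦ u·s(a)` (all the points `j/H_k` in `[0,1]`), and
* for every gap `m` the value `c_m` of the saving exponent `N_a` on `(B_m/L, B_{m+1}/L)` with a witness ordering.
`gapOK` checks ONE gap in the kernel: the 28 integer parts at the gap (floor inequalities in `ℕ`), the verified subset
DP of `ConeGammaSavingEval` bounding `max_σ` by `c_m`, and the witness attaining `c_m`; `gapsOK` runs it over a range of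
gaps (so that big tables can be checked in chunks). **`phi30_eq_digammaSum_of_gaps`**: if the header holds and every
gap checks, then `Φ(a) = Σ_{1 ≤ m < M} c_m · (ψ(B_{m+1}/L) − ψ(B_m/L))` EXACTLY (`phi30_eq_digammaSum`, `ψ = Complex.digamma`).
Second half: the INTERVAL step — `rePsiBox` (an enclosure of `Re ψ(p/q)` by the tree's kernel digamma engine
`MC.digammaBox`, `Literature/Analysis/ValidatedNumerics/DigammaKernelValues`), `psiSum` (the digamma sum in fixed-point
interval arithmetic, each `ψ` value computed once) and **`mem_psiSum`**; so a window `Φ(a) ∈ [lo, hi]` is ONE more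
`decide +kernel` (`psiWindow`, **`mem_Icc_of_psiWindow`**).
-/

noncomputable section

open Finset Set

namespace Summit.KontsevichZagierPeriods.Zeta5Search.Barrier.ConeGamma

/-! ### The pair-index table as arithmetic (fast kernel lookups) -/

/-- `idxOf` packed in base 32 (both orientations): digit `8i+j` is the form index of the pair `{i,j}`. -/
def idxTab : ℕ := 14266623515224457230353784592693883080372945488630086906483786627262592116062828134669705381312

/-- The form index of the pair `{i,j}` (symmetric; junk on the diagonal). -/
def idxNat (i j : ℕ) : ℕ := idxTab / 32 ^ (8 * i + j) % 32

/-- Agreement with `idxOf` on `i < j`. -/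
theorem val_idxOf_eq_idxNat : ∀ i j : Fin 8, i < j → ((idxOf i j : Fin 28) : ℕ) = idxNat i j := by decide +kernel

/-- Symmetry of the packed table. -/
theorem idxNat_comm : ∀ i j : Fin 8, idxNat i j = idxNat j i := by decide +kernel

/-- The packed table takes values `< 28`. -/
theorem idxNat_lt : ∀ i j : Fin 8, i ≠ j → idxNat i j < 28 := by decide +kernel

/-! ### One gap: integer parts, DP bound, witness -/

/-- UNTRUSTED encoder of the 28 integer parts at the gap's midpoint, base `2^10`. -/
def encN (H : ℕ → ℕ) (Bm Bm1 L : ℕ) : ℕ :=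
  ((List.range 28).map fun k => (H k * (Bm + Bm1) / (2 * L)) * 1024 ^ k).sum

/-- Digit `k` of a base-`2^10` number. -/
def digit (E k : ℕ) : ℕ := E / 1024 ^ k % 1024

/-- The pair table read from the packed integer parts. -/
def nOf (E : ℕ) (i j : ℕ) : ℤ := (digit E (idxNat i j) : ℤ)

/-- CHECK of the integer parts: `digit_k · L ≤ H_k · B_m` and `H_k · B_{m+1} ≤ (digit_k + 1) · L` for all `k < 28`
(so `⌊u·H_k⌋ = digit_k` for every `u ∈ (B_m/L, B_{m+1}/L)`). -/
def floorsOK (H : ℕ → ℕ) (Bm Bm1 L E : ℕ) : Bool :=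
  (List.range 28).all fun k => decide (digit E k * L ≤ H k * Bm) && decide (H k * Bm1 ≤ (digit E k + 1) * L)

/-- CHECK of one gap: integer parts, verified DP table with maximum `≤ c`, witness ordering attaining `c`. -/
def gapOK (H : ℕ → ℕ) (L Bm Bm1 : ℕ) (c : ℤ) (w : List (Fin 7)) : Bool :=
  let E := encN H Bm Bm1 L
  let T := tblOf (dpBuild (nOf E))
  floorsOK H Bm Bm1 L E && dpCheck (nOf E) T && decide (dpMax (nOf E) T - pathValId (nOf E) ≤ c) &&
    decide w.Nodup && (w.length == 7) && decide (c ≤ pathValN (nOf E) (w.map Fin.val) - pathValId (nOf E))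

/-- CHECK of the gaps `lo ≤ m < lo + len` of a table: strict increase of the breakpoints and `gapOK`. -/
def gapsOK (H : ℕ → ℕ) (L : ℕ) (B : List ℕ) (cw : List (ℤ × List (Fin 7))) (lo len : ℕ) : Bool :=
  (List.range' lo len).all fun m =>
    decide (B.getD m 0 < B.getD (m + 1) 0) &&
      gapOK H L (B.getD m 0) (B.getD (m + 1) 0) (cw.getD m (0, [])).1 (cw.getD m (0, [])).2

/-! ### Soundness -/

/-- The floor check gives the integer parts on the open gap. -/
theorem floor_eq_of_floorsOK {H : ℕ → ℕ} {Bm Bm1 L E : ℕ} (hL : 0 < L) (h : floorsOK H Bm Bm1 L E = true)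
    {k : ℕ} (hk : k < 28) {u : ℝ} (hu : u ∈ Ioo ((Bm : ℝ) / L) ((Bm1 : ℝ) / L)) :
    ⌊u * (H k : ℝ)⌋ = (digit E k : ℤ) := by
  unfold floorsOK at h
  rw [List.all_eq_true] at h
  have hk' := h k (List.mem_range.2 hk)
  rw [Bool.and_eq_true, decide_eq_true_eq, decide_eq_true_eq] at hk'
  obtain ⟨h1, h2⟩ := hk'
  have hLr : (0 : ℝ) < L := by exact_mod_cast hL
  have h1r : (digit E k : ℝ) * L ≤ (H k : ℝ) * Bm := by exact_mod_cast h1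
  have h2r : (H k : ℝ) * Bm1 ≤ ((digit E k : ℝ) + 1) * L := by exact_mod_cast h2
  obtain ⟨hu1, hu2⟩ := hu
  rw [Int.floor_eq_iff]
  push_cast
  constructor
  · -- digit ≤ u * H k
    have hH : (0 : ℝ) ≤ H k := Nat.cast_nonneg _
    have : (digit E k : ℝ) ≤ (Bm : ℝ) / L * H k := by
      rw [div_mul_eq_mul_div, le_div_iff₀ hLr]; linarith
    exact this.trans (by nlinarith)
  · rcases Nat.eq_zero_or_pos (H k) with h0 | hpos
    · simp [h0]; positivity
    · have hH : (0 : ℝ) < H k := by exact_mod_cast hpos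
      have : (Bm1 : ℝ) / L * H k ≤ (digit E k : ℝ) + 1 := by
        rw [div_mul_eq_mul_div, div_le_iff₀ hLr]; linarith
      exact lt_of_lt_of_le (by nlinarith) this

/-- The pair table of `u·s(a)` on the gap is `nOf E`. -/
theorem floor_pairForm_eq_nOf {a : Dir} {H : ℕ → ℕ} (hH : ∀ k : Fin 28, h28 a k = (H k : ℝ)) {Bm Bm1 L E : ℕ}
    (hL : 0 < L) (h : floorsOK H Bm Bm1 L E = true) {u : ℝ} (hu : u ∈ Ioo ((Bm : ℝ) / L) ((Bm1 : ℝ) / L)) :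
    ∀ i j : Fin 8, i ≠ j → ⌊pairForm (u • sParam a) i j⌋ = nOf E i j := by
  intro i j hij
  have key : ∀ i j : Fin 8, i < j → ⌊pairForm (u • sParam a) i j⌋ = nOf E i j := by
    intro i j hlt
    rw [pairForm_eq_phiForm_idxOf _ hlt, phiForm_smul_sParam, hH, nOf, ← val_idxOf_eq_idxNat i j hlt]
    have hk : ((idxOf i j : Fin 28) : ℕ) < 28 := (idxOf i j).isLt
    have := floor_eq_of_floorsOK hL h hk hu
    convert this using 2
  rcases lt_or_gt_of_ne hij with hlt | hgt
  · exact key i j hlt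
  · rw [pairForm_comm, key j i hgt, nOf, nOf, idxNat_comm]

/-- **One gap**: on `(B_m/L, B_{m+1}/L)` the saving exponent is the certified value `c`. -/
theorem savingN_eq_of_gapOK {a : Dir} (ha : BZBox a) {H : ℕ → ℕ} (hH : ∀ k : Fin 28, h28 a k = (H k : ℝ))
    {L Bm Bm1 : ℕ} (hL : 0 < L) {c : ℤ} {w : List (Fin 7)} (h : gapOK H L Bm Bm1 c w = true) {u : ℝ}
    (hu : u ∈ Ioo ((Bm : ℝ) / L) ((Bm1 : ℝ) / L)) : savingN a u = c := by
  unfold gapOK at h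
  simp only [Bool.and_eq_true, decide_eq_true_eq, beq_iff_eq] at h
  obtain ⟨⟨⟨⟨⟨hfl, hdp⟩, hup⟩, hnd⟩, hlen⟩, hlo⟩ := h
  rw [savingN_eq_torusN_of_BZBox ha]
  exact torusN_eq_of_cert (floor_pairForm_eq_nOf hH hL hfl hu) hdp hup hnd hlen hlo

/-- `gapsOK` delivers the per-gap facts on its range. -/
theorem gapsOK_sound {H : ℕ → ℕ} {L : ℕ} {B : List ℕ} {cw : List (ℤ × List (Fin 7))} {lo len : ℕ}
    (h : gapsOK H L B cw lo len = true) {m : ℕ} (h1 : lo ≤ m) (h2 : m < lo + len) :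
    B.getD m 0 < B.getD (m + 1) 0 ∧
      gapOK H L (B.getD m 0) (B.getD (m + 1) 0) (cw.getD m (0, [])).1 (cw.getD m (0, [])).2 = true := by
  unfold gapsOK at h
  rw [List.all_eq_true] at h
  have hm : m ∈ List.range' lo len := by rw [List.mem_range'_1]; omega
  have := h m hm
  rwa [Bool.and_eq_true, decide_eq_true_eq] at this

/-- **THE GAP CERTIFICATE THEOREM**: header (`B₀ = 0`, `B_M = L > 0`) and all `M` gaps checked ⇒
`Φ(a) = Σ_{1 ≤ m < M} c_m · (ψ(B_{m+1}/L) − ψ(B_m/L))` exactly. -/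
theorem phi30_eq_digammaSum_of_gaps {a : Dir} (ha : BZBox a) {H : ℕ → ℕ} (hH : ∀ k : Fin 28, h28 a k = (H k : ℝ))
    {L : ℕ} (hL : 0 < L) {B : List ℕ} {cw : List (ℤ × List (Fin 7))} {M : ℕ} (hB0 : B.getD 0 0 = 0)
    (hBM : B.getD M 0 = L)
    (hg : ∀ m < M, B.getD m 0 < B.getD (m + 1) 0 ∧
      gapOK H L (B.getD m 0) (B.getD (m + 1) 0) (cw.getD m (0, [])).1 (cw.getD m (0, [])).2 = true) :
    phi30 a = ∑ m ∈ Finset.Ico 1 M, ((cw.getD m (0, [])).1 : ℝ) *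
      (Complex.digamma (((B.getD (m + 1) 0 : ℝ) / L : ℝ) : ℂ) - Complex.digamma (((B.getD m 0 : ℝ) / L : ℝ) : ℂ)).re := by
  have hLr : (0 : ℝ) < L := by exact_mod_cast hL
  have hper : ∀ k : Fin 28, ∃ z : ℤ, (1 : ℝ) * h28 a k = z := fun k => ⟨H k, by rw [hH]; push_cast; ring⟩
  have h := phi30_eq_digammaSum ha one_pos hper (M := M) (b := fun m => (B.getD m 0 : ℝ) / L)
    (c := fun m => (cw.getD m (0, [])).1) (by show ((B.getD 0 0 : ℕ) : ℝ) / L = 0; rw [hB0]; simp)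
    (by show ((B.getD M 0 : ℕ) : ℝ) / L = 1; rw [hBM]; exact div_self hLr.ne')
    (fun m hm => by
      have := (hg m hm).1
      exact div_lt_div_of_pos_right (by exact_mod_cast this) hLr)
    (fun m hm u hu => savingN_eq_of_gapOK ha hH hL (hg m hm).2 hu)
  rw [h, div_one]
  refine Finset.sum_congr rfl fun m _ => ?_
  simp only [div_one]

/-! ### The interval step: the digamma sum in the kernel -/

open Literature.Analysis.ValidatedNumerics.NumericsMP

/-- Enclosure of `Re ψ(p/q)` (`p, q > 0`) at scale `S`: the real part of the tree's `MC.digammaBox` on the point box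
`p/q + 0i` (`K` log-series terms, shift `J`, Bernoulli table `B₂..B₂₀`). -/
def rePsiBox (S K J : ℕ) (piI : MI) (p q : ℕ) : Option MI :=
  match MC.digammaBox S K J piI MC.bernoulliTable (MC.ofMI S (MI.ofFrac S p q)) with
  | some Y => some Y.re
  | none => none

/-- `rePsiBox ∋ Re ψ(p/q)`. -/
theorem mem_rePsiBox {S : ℕ} (hS : 0 < S) {K J : ℕ} {piI : MI} (hpi : MI.mem S Real.pi piI) {p q : ℕ}
    (hq : 0 < q) {I : MI} (h : rePsiBox S K J piI p q = some I) :
    MI.mem S (Complex.digamma (((p : ℝ) / q : ℝ) : ℂ)).re I := by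
  unfold rePsiBox at h
  split at h
  · rename_i Y hY
    simp only [Option.some.injEq] at h
    subst h
    have hw : MC.mem S ((((p : ℝ) / q : ℝ) : ℂ)) (MC.ofMI S (MI.ofFrac S p q)) := by
      have := MC.mem_ofMI (S := S) (MI.mem_ofFrac S (p : ℤ) hq)
      simpa using this
    exact (MC.mem_digammaBox_table hS hpi hY hw).1
  · simp at h

/-- Running interval sum of `c_k · (Re ψ(B_{k+1}/L) − Re ψ(B_k/L))` for `k = m, …, m+n−1`, given a box `prev` for
`Re ψ(B_m/L)`; every digamma value is computed once. -/
def psiSumGo (S K J : ℕ) (piI : MI) (L : ℕ) (B : List ℕ) (cw : List (ℤ × List (Fin 7))) :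
    ℕ → ℕ → MI → Option MI
  | _, 0, _ => some (MI.ofInt S 0)
  | m, n + 1, prev =>
    match rePsiBox S K J piI (B.getD (m + 1) 0) L with
    | none => none
    | some next =>
      match psiSumGo S K J piI L B cw (m + 1) n next with
      | none => none
      | some rest => some (((next.sub prev).mulInt (cw.getD m (0, [])).1).add rest)

/-- Soundness of the running sum. -/
theorem mem_psiSumGo {S : ℕ} (hS : 0 < S) {K J : ℕ} {piI : MI} (hpi : MI.mem S Real.pi piI) {L : ℕ} (hL : 0 < L)
    (B : List ℕ) (cw : List (ℤ × List (Fin 7))) :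
    ∀ (n m : ℕ) (prev I : MI),
      MI.mem S (Complex.digamma ((((B.getD m 0 : ℕ) : ℝ) / L : ℝ) : ℂ)).re prev →
      psiSumGo S K J piI L B cw m n prev = some I →
      MI.mem S (∑ k ∈ Finset.Ico m (m + n), ((cw.getD k (0, [])).1 : ℝ) *
        (Complex.digamma ((((B.getD (k + 1) 0 : ℕ) : ℝ) / L : ℝ) : ℂ) -
          Complex.digamma ((((B.getD k 0 : ℕ) : ℝ) / L : ℝ) : ℂ)).re) I := by
  intro n
  induction n with
  | zero =>
    intro m prev I _ h
    simp only [psiSumGo, Option.some.injEq] at h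
    subst h
    simpa using MI.mem_ofInt S 0
  | succ n ih =>
    intro m prev I hprev h
    simp only [psiSumGo] at h
    split at h
    · simp at h
    · rename_i next hnext
      split at h
      · simp at h
      · rename_i rest hrest
        simp only [Option.some.injEq] at h
        subst h
        have hn : MI.mem S (Complex.digamma ((((B.getD (m + 1) 0 : ℕ) : ℝ) / L : ℝ) : ℂ)).re next :=
          mem_rePsiBox hS hpi hL hnext
        have hr := ih (m + 1) next rest hn hrest
        rw [Finset.sum_eq_sum_Ico_succ_bot (by omega : m < m + (n + 1)),
          show m + (n + 1) = m + 1 + n by ring]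
        have ht := MI.mem_mulInt (MI.mem_sub hn hprev) (cw.getD m (0, [])).1
        have := MI.mem_add ht hr
        convert this using 1
        rw [Complex.sub_re]
        ring

/-- The whole digamma sum `Σ_{1 ≤ m < M} c_m · (Re ψ(B_{m+1}/L) − Re ψ(B_m/L))`, with `π` by Machin (`Kpi` terms). -/
def psiSum (S K J Kpi : ℕ) (L : ℕ) (B : List ℕ) (cw : List (ℤ × List (Fin 7))) (M : ℕ) : Option MI :=
  match MI.piMachin S Kpi with
  | none => none
  | some piI =>
    match rePsiBox S K J piI (B.getD 1 0) L with
    | none => none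
    | some first => psiSumGo S K J piI L B cw 1 (M - 1) first

/-- **Soundness of the interval digamma sum.** -/
theorem mem_psiSum {S : ℕ} (hS : 0 < S) {K J Kpi L : ℕ} (hL : 0 < L) {B : List ℕ} {cw : List (ℤ × List (Fin 7))}
    {M : ℕ} (hM : 1 ≤ M) {I : MI} (h : psiSum S K J Kpi L B cw M = some I) :
    MI.mem S (∑ m ∈ Finset.Ico 1 M, ((cw.getD m (0, [])).1 : ℝ) *
      (Complex.digamma ((((B.getD (m + 1) 0 : ℕ) : ℝ) / L : ℝ) : ℂ) -
        Complex.digamma ((((B.getD m 0 : ℕ) : ℝ) / L : ℝ) : ℂ)).re) I := by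
  unfold psiSum at h
  split at h
  · simp at h
  · rename_i piI hpi
    split at h
    · simp at h
    · rename_i first hfirst
      have hpi' := MI.mem_piMachin hS hpi
      have h1 := mem_rePsiBox hS hpi' hL hfirst
      have := mem_psiSumGo hS hpi' hL B cw (M - 1) 1 first I h1 h
      rwa [show 1 + (M - 1) = M by omega] at this

/-- CHECK that the digamma sum lies in the window `[lo/den, hi/den]`. -/
def psiWindow (S K J Kpi : ℕ) (L : ℕ) (B : List ℕ) (cw : List (ℤ × List (Fin 7))) (M : ℕ) (lo hi : ℤ)
    (den : ℕ) : Bool :=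
  match psiSum S K J Kpi L B cw M with
  | some I => decide (lo * (S : ℤ) ≤ I.lo * den) && decide (I.hi * (den : ℤ) ≤ hi * S)
  | none => false

/-- **Soundness of the window check**: the digamma sum lies in `[lo/den, hi/den]`. -/
theorem mem_Icc_of_psiWindow {S : ℕ} (hS : 0 < S) {K J Kpi L : ℕ} (hL : 0 < L) {B : List ℕ}
    {cw : List (ℤ × List (Fin 7))} {M : ℕ} (hM : 1 ≤ M) {lo hi : ℤ} {den : ℕ} (hden : 0 < den)
    (h : psiWindow S K J Kpi L B cw M lo hi den = true) :
    (∑ m ∈ Finset.Ico 1 M, ((cw.getD m (0, [])).1 : ℝ) *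
      (Complex.digamma ((((B.getD (m + 1) 0 : ℕ) : ℝ) / L : ℝ) : ℂ) -
        Complex.digamma ((((B.getD m 0 : ℕ) : ℝ) / L : ℝ) : ℂ)).re) ∈ Icc ((lo : ℝ) / den) ((hi : ℝ) / den) := by
  unfold psiWindow at h
  split at h
  · rename_i I hI
    rw [Bool.and_eq_true, decide_eq_true_eq, decide_eq_true_eq] at h
    obtain ⟨h1, h2⟩ := h
    obtain ⟨hm1, hm2⟩ := mem_psiSum hS hL hM hI
    have hSr : (0 : ℝ) < S := by exact_mod_cast hS
    have hdr : (0 : ℝ) < den := by exact_mod_cast hden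
    have h1r : (lo : ℝ) * S ≤ (I.lo : ℝ) * den := by exact_mod_cast h1
    have h2r : (I.hi : ℝ) * den ≤ (hi : ℝ) * S := by exact_mod_cast h2
    constructor
    · rw [div_le_iff₀ hdr]; nlinarith
    · rw [le_div_iff₀ hdr]; nlinarith
  · simp at h

end Summit.KontsevichZagierPeriods.Zeta5Search.Barrier.ConeGamma

end
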